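import Literature.AlgebraicGeometry.Deformation.SmallExtensionFactorization
import Mathlib.Algebra.Module.Torsion.Basic
import Mathlib.RingTheory.Ideal.Quotient.Operations
import HarnessLib

/-!
# A surjection of Artin local rings is climbed one PRINCIPAL SMALL κ-LINE at a time
# (Stacks 06GE «`B → B/(x_1) → … → B/(x_1, …, x_n) ≅ A`», in induction form, with the κ-line structure of each kernel)

Layer `Literature/RingTheory/Artinian`, namespace `Literature.RingTheory.Artinian`. PROOF FILE, THEOREMS ONLY (no definition,
no instance, no notation, no named fact, no `sorry`). Cell `hodgecm-mathlib`, P6 sub-desk P6b FINAL-CONSUMER board (19:58:46Z):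
the pure-algebra half of **FC-3 «induction on the length of `J`»** (consumer `AbelianSchemes/AbelianSchemeLiftOfClassZeroInduction`,
LA3-p02 (g5)); every statement about abelian schemes stays with the consumer — this file only climbs the ideal lattice of an
Artin local ring and reads each rung in the quotient ring, in the letters of FC-2 §2 (ring `A ⧸ J'`, ideal `J.map (mk J')`,
`φ : ↥_ ≃ₗ[_] ResidueField _`).

THE PRINT. [StacksProject, Tag 06GE (Lemma 90.3.3)]: «Let `f : B → A` be a surjective ring map in `𝒞_Λ`. Then `f` can be factored
as a composition of small extensions», proof: «… it suffices to prove the lemma when … `I` is annihilated by `𝔪_B`. In this case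
`I` is a `k`-vector space … Take a basis `x_1, …, x_n` of `I` … to get a factorization `B → B/(x_1) → … → B/(x_1, …, x_n) ≅ A` of
`f` into a composition of small extensions.» [StacksProject, Tag 06GD (Definition 90.3.2)]: a small extension has kernel «a nonzero
principal ideal which is annihilated by `𝔪_B`» — hence a `k`-vector space of dimension one ([FantechiManetti1998ObstructionCalculus,
Def. 1.0, p. 543]: «principal if `dim_k K(e) = 1`»). The tree already holds the basis-free rung ★
`Deformation.Ideal.exists_lt_sup_span_singleton_eq` (`J ≠ 0 ⇒ ∃ J' < J, t : 𝔪J ≤ J', t ∈ J ∖ J', J' ⊔ (t) = J`); this file adds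
the κ-line reading of the rung and the induction principle.

WHAT IS TYPED.
* §1 `torsionOf_eq_maximalIdeal`, **`nonempty_spanSingleton_linearEquiv_residueField`** — in a LOCAL ring `B`, a nonzero `y` killed
  by `𝔪_B` spans a κ-LINE: `(y) ≃ₗ[B] κ(B)` (Mathlib `Ideal.quotTorsionOfEquivSpanSingleton`); `maximalIdeal_mul_span_singleton_eq_bot_iff`.
* §2 the rung read in `A ⧸ J'`: `isLocalRing_quotient`, `map_mk_le_maximalIdeal`, `map_mk_ne_top`, `maximalIdeal_quotient_mul_map_mk_eq_bot`
  (`𝔪_{A/J'} · (J/J') = 0` from `𝔪_A J ≤ J'`), `map_mk_eq_span_singleton`, `mk_ne_zero`, **`nonempty_map_mk_linearEquiv_residueField`**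
  (`J/J' ≃ₗ[A/J'] κ(A/J')` from `J' ⊔ (t) = J`, `t ∉ J'`); the ring identification `(A ⧸ J') ⧸ (J/J') ≃+* A ⧸ J` over the two
  quotient maps is Mathlib's `DoubleQuot.quotQuotEquivQuotOfLE` ∕ `quotQuotEquivQuotOfLE_comp_quotQuotMk` (not restated).
* §3 **`induction_on_principalSmall`** — `A` Artinian local, ANY motive `Q : Ideal A → Prop`: from `Q ⊥` and the rung
  «`J' < J`, `𝔪J ≤ J'`, `t ∈ J ∖ J'`, `J' ⊔ (t) = J`, `Q J'` ⟹ `Q J`» conclude `Q J` for every `J` (Mathlib `IsArtinian.induction` +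
  ★ rung); **`induction_on_principalSmall_le`** — the same below a fixed `J₀` (the step may use `J ≤ J₀`), the shape FC-3 quantifies
  its vanishing hypothesis over; `descent_on_principalSmall` — the downward reading (`Q J₀`, rungs transfer `Q J → Q J'`, ⟹ `Q ⊥`).

HC_CM is proved only modulo the printed citations until rung 0 closes; nothing here bears on a summit statement (count-neutral).

## References
* [StacksProject] The Stacks Project, Tag 06GD (Definition 90.3.2), Tag 06GE (Lemma 90.3.3 and its proof).
* [FantechiManetti1998ObstructionCalculus] B. Fantechi, M. Manetti, *Obstruction calculus for functors of Artin rings, I*,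
  J. Algebra 202 (1998), Def. 1.0 (p. 543).
-/

noncomputable section

universe u

open IsLocalRing

namespace Literature.RingTheory.Artinian

/-! ## §1 A nonzero element killed by the maximal ideal spans a κ-line -/

section Line

variable {B : Type u} [CommRing B] [IsLocalRing B]

/-- In a local ring, the annihilator ideal (`Ideal.torsionOf`) of a NONZERO element killed by `𝔪` is `𝔪`: it contains `𝔪`,
and a unit in it would force `y = 0`. [cite: StacksProject, Tag 06GD (Definition 90.3.2)] -/
theorem torsionOf_eq_maximalIdeal {y : B} (hy : y ≠ 0) (hmy : ∀ m ∈ maximalIdeal B, m * y = 0) :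
    Ideal.torsionOf B B y = maximalIdeal B := by
  refine le_antisymm (fun a ha => ?_) (fun m hm => ?_)
  · rw [Ideal.mem_torsionOf_iff, smul_eq_mul] at ha
    rw [IsLocalRing.mem_maximalIdeal, mem_nonunits_iff]
    intro hu
    apply hy
    have h2 : hu.unit⁻¹.1 * (a * y) = 0 := by rw [ha, mul_zero]
    rwa [← mul_assoc, IsUnit.val_inv_mul, one_mul] at h2
  · rw [Ideal.mem_torsionOf_iff, smul_eq_mul]
    exact hmy m hm

/-- **A nonzero element killed by `𝔪` spans a κ-LINE**: `(y) ≃ₗ[B] κ(B)` («`Ker(f)` is a nonzero principal ideal which is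
annihilated by `𝔪_B`», i.e. «principal: `dim_k K(e) = 1`»). [cite: StacksProject, Tag 06GD (Definition 90.3.2)]
[cite: FantechiManetti1998ObstructionCalculus, Def. 1.0 (p. 543)] -/
theorem nonempty_spanSingleton_linearEquiv_residueField {y : B} (hy : y ≠ 0)
    (hmy : ∀ m ∈ maximalIdeal B, m * y = 0) :
    Nonempty (↥(Ideal.span {y}) ≃ₗ[B] ResidueField B) :=
  ⟨(Ideal.quotTorsionOfEquivSpanSingleton B B y).symm.trans
    (Submodule.quotEquivOfEq _ _ (torsionOf_eq_maximalIdeal hy hmy))⟩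

/-- `𝔪 · (y) = 0` iff every element of `𝔪` kills `y`. [cite: StacksProject, Tag 06GD (Definition 90.3.2)] -/
theorem maximalIdeal_mul_span_singleton_eq_bot_iff (y : B) :
    maximalIdeal B * Ideal.span {y} = ⊥ ↔ ∀ m ∈ maximalIdeal B, m * y = 0 := by
  constructor
  · intro h m hm
    have hmem : m * y ∈ maximalIdeal B * Ideal.span {y} := Ideal.mul_mem_mul hm (Ideal.mem_span_singleton_self y)
    rwa [h, Ideal.mem_bot] at hmem
  · intro h
    rw [eq_bot_iff, Ideal.mul_le]
    intro r hr s hs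
    obtain ⟨c, rfl⟩ := Ideal.mem_span_singleton'.1 hs
    rw [Ideal.mem_bot, mul_left_comm, h r hr, mul_zero]

end Line

/-! ## §2 The rung `J' ⊔ (t) = J` read in the quotient ring `A ⧸ J'` (letters of FC-2 §2) -/

section Rung

variable {A : Type u} [CommRing A] [IsLocalRing A] {J J' : Ideal A} {t : A}

/-- The quotient of a local ring by a proper ideal is local (Mathlib `IsLocalRing.of_surjective'`); recorded so the consumer can
`haveI` it at each rung. [cite: StacksProject, Tag 06GE (Lemma 90.3.3, proof)] -/
theorem isLocalRing_quotient (hJ' : J' ≠ ⊤) : IsLocalRing (A ⧸ J') :=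
  haveI := Ideal.Quotient.nontrivial_iff.mpr hJ'
  IsLocalRing.of_surjective' (Ideal.Quotient.mk J') Ideal.Quotient.mk_surjective

omit [IsLocalRing A] in
/-- `J/J' ≠ ⊤` in `A ⧸ J'` for `J' ≤ J` proper (the next rung is again a proper quotient): a lift `b ∈ J` of `1` would put
`1 = (1 - b) + b` in `J`. [cite: StacksProject, Tag 06GE (Lemma 90.3.3, proof)] -/
theorem map_mk_ne_top (hJ : J ≠ ⊤) (hJ'J : J' ≤ J) : J.map (Ideal.Quotient.mk J') ≠ ⊤ := by
  intro h
  have h1 : (1 : A ⧸ J') ∈ J.map (Ideal.Quotient.mk J') := h ▸ Submodule.mem_top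
  obtain ⟨b, hb, hb1⟩ := (Ideal.mem_map_iff_of_surjective _ Ideal.Quotient.mk_surjective).1 h1
  have hb' : 1 - b ∈ J := by
    refine hJ'J (Ideal.Quotient.eq_zero_iff_mem.1 ?_)
    rw [map_sub, hb1, map_one, sub_self]
  exact hJ ((Ideal.eq_top_iff_one J).2 (by simpa using J.add_mem hb' hb))

omit [IsLocalRing A] in
/-- The image `J/J'` of a proper ideal `J ≥ J'` consists of non-units of `A ⧸ J'`.
[cite: StacksProject, Tag 06GE (Lemma 90.3.3, proof)] -/
theorem map_mk_le_maximalIdeal (hJ : J ≠ ⊤) (hJ'J : J' ≤ J) [IsLocalRing (A ⧸ J')] :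
    J.map (Ideal.Quotient.mk J') ≤ maximalIdeal (A ⧸ J') :=
  IsLocalRing.le_maximalIdeal (map_mk_ne_top hJ hJ'J)

/-- **The rung is small**: `𝔪_{A/J'} · (J/J') = 0` as soon as `𝔪_A · J ≤ J'`. [cite: StacksProject, Tag 06GE (Lemma 90.3.3, proof)]
[cite: StacksProject, Tag 06GD (Definition 90.3.2)] -/
theorem maximalIdeal_quotient_mul_map_mk_eq_bot (hmJ : maximalIdeal A * J ≤ J') [IsLocalRing (A ⧸ J')] :
    maximalIdeal (A ⧸ J') * J.map (Ideal.Quotient.mk J') = ⊥ := by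
  rw [eq_bot_iff, Ideal.mul_le]
  intro r hr s hs
  obtain ⟨a, rfl⟩ := Ideal.Quotient.mk_surjective r
  obtain ⟨b, hb, rfl⟩ := (Ideal.mem_map_iff_of_surjective _ Ideal.Quotient.mk_surjective).1 hs
  have ha : a ∈ maximalIdeal A := by
    rw [IsLocalRing.mem_maximalIdeal, mem_nonunits_iff] at hr ⊢
    exact fun hu => hr (hu.map (Ideal.Quotient.mk J'))
  rw [← map_mul, Ideal.mem_bot, Ideal.Quotient.eq_zero_iff_mem]
  exact hmJ (Ideal.mul_mem_mul ha hb)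

omit [IsLocalRing A] in
/-- **The rung is principal**: `J' ⊔ (t) = J ⇒ J/J' = (t̄)` in `A ⧸ J'`. [cite: StacksProject, Tag 06GE (Lemma 90.3.3, proof)] -/
theorem map_mk_eq_span_singleton (hJ : J' ⊔ Ideal.span {t} = J) :
    J.map (Ideal.Quotient.mk J') = Ideal.span {Ideal.Quotient.mk J' t} := by
  rw [← hJ, Ideal.map_sup, Ideal.map_quotient_self, bot_sup_eq, Ideal.map_span, Set.image_singleton]

omit [IsLocalRing A] in
/-- … with `t̄ ≠ 0` when `t ∉ J'`. [cite: StacksProject, Tag 06GD (Definition 90.3.2)] -/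
theorem mk_ne_zero (htJ' : t ∉ J') : Ideal.Quotient.mk J' t ≠ 0 :=
  fun h => htJ' (Ideal.Quotient.eq_zero_iff_mem.1 h)

/-- **The rung is a κ-line**: `J/J' ≃ₗ[A/J'] κ(A/J')` — the datum `φ` of a PRINCIPAL small extension in the letters of FC-2 §2,
for the ring `A ⧸ J'` and the ideal `J.map (mk J')`. [cite: StacksProject, Tag 06GD (Definition 90.3.2)]
[cite: FantechiManetti1998ObstructionCalculus, Def. 1.0 (p. 543)] -/
theorem nonempty_map_mk_linearEquiv_residueField (hmJ : maximalIdeal A * J ≤ J') (htJ' : t ∉ J')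
    (hJ : J' ⊔ Ideal.span {t} = J) [IsLocalRing (A ⧸ J')] :
    Nonempty (↥(J.map (Ideal.Quotient.mk J')) ≃ₗ[A ⧸ J'] ResidueField (A ⧸ J')) := by
  have hsmall := maximalIdeal_quotient_mul_map_mk_eq_bot (J := J) hmJ
  rw [map_mk_eq_span_singleton hJ] at hsmall
  obtain ⟨e⟩ := nonempty_spanSingleton_linearEquiv_residueField (mk_ne_zero htJ')
    ((maximalIdeal_mul_span_singleton_eq_bot_iff _).1 hsmall)
  exact ⟨(LinearEquiv.ofEq _ _ (map_mk_eq_span_singleton hJ)).trans e⟩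

/-- **One rung, packaged** (what FC-2 §2 is applied to at each step of FC-3): for `J` proper, `𝔪J ≤ J'`, `t ∉ J'`, `J' ⊔ (t) = J`,
the ring `A ⧸ J'` is local, the ideal `J/J'` is proper, killed by `𝔪_{A/J'}`, and a κ-line.
[cite: StacksProject, Tag 06GE (Lemma 90.3.3, proof)] [cite: StacksProject, Tag 06GD (Definition 90.3.2)] -/
theorem principalSmallLine_map_mk (hJtop : J ≠ ⊤) (hJ'J : J' < J) (hmJ : maximalIdeal A * J ≤ J') (htJ' : t ∉ J')
    (hJ : J' ⊔ Ideal.span {t} = J) :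
    ∃ _ : IsLocalRing (A ⧸ J'),
      J.map (Ideal.Quotient.mk J') ≠ ⊤ ∧
        maximalIdeal (A ⧸ J') * J.map (Ideal.Quotient.mk J') = ⊥ ∧
          Nonempty (↥(J.map (Ideal.Quotient.mk J')) ≃ₗ[A ⧸ J'] ResidueField (A ⧸ J')) := by
  have hJ'top : J' ≠ ⊤ := (lt_of_lt_of_le hJ'J le_top).ne
  haveI := isLocalRing_quotient hJ'top
  exact ⟨this, map_mk_ne_top hJtop hJ'J.le, maximalIdeal_quotient_mul_map_mk_eq_bot hmJ,
    nonempty_map_mk_linearEquiv_residueField hmJ htJ' hJ⟩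

end Rung

/-! ## §3 Induction along principal small rungs (Stacks 06GE in induction form) -/

section Induction

variable {A : Type u} [CommRing A] [IsArtinianRing A] [IsLocalRing A]

/-- **Induction along principal small rungs.** `A` Artinian local, `Q` any property of ideals: if `Q ⊥` and `Q` climbs every rung
(«`J' < J`, `𝔪J ≤ J'`, `t ∈ J`, `t ∉ J'`, `J' ⊔ (t) = J`, `Q J'` ⟹ `Q J`»), then `Q J` for every ideal `J` — i.e. `A → A/J` is reached
from `A = A/0` through the principal small extensions `A/J' → A/J`; strong induction on the Artinian lattice of ideals through ★
`Deformation.Ideal.exists_lt_sup_span_singleton_eq`. [cite: StacksProject, Tag 06GE (Lemma 90.3.3 and proof)] -/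
theorem induction_on_principalSmall {Q : Ideal A → Prop} (hbot : Q ⊥)
    (hstep : ∀ ⦃J J' : Ideal A⦄ (t : A), J' < J → maximalIdeal A * J ≤ J' → t ∈ J → t ∉ J' →
      J' ⊔ Ideal.span {t} = J → Q J' → Q J)
    (J : Ideal A) : Q J := by
  induction J using IsArtinian.induction with
  | hgt J ih =>
    by_cases hJ : J = ⊥
    · subst hJ
      exact hbot
    · obtain ⟨J', t, hmJ, hlt, htJ, htJ', hsup⟩ :=
        Literature.AlgebraicGeometry.Deformation.Ideal.exists_lt_sup_span_singleton_eq J hJ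
      exact hstep t hlt hmJ htJ htJ' hsup (ih J' hlt)

/-- **Induction along principal small rungs below a fixed ideal `J₀`** (the rungs of `A → A/J₀`): the step may assume `J ≤ J₀`,
which is where FC-3 instantiates a hypothesis quantified over the sub-steps of `J₀`.
[cite: StacksProject, Tag 06GE (Lemma 90.3.3 and proof)] -/
theorem induction_on_principalSmall_le (J₀ : Ideal A) {Q : Ideal A → Prop} (hbot : Q ⊥)
    (hstep : ∀ ⦃J J' : Ideal A⦄ (t : A), J ≤ J₀ → J' < J → maximalIdeal A * J ≤ J' → t ∈ J → t ∉ J' →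
      J' ⊔ Ideal.span {t} = J → Q J' → Q J)
    {J : Ideal A} (hJ : J ≤ J₀) : Q J := by
  revert hJ
  refine induction_on_principalSmall (Q := fun J => J ≤ J₀ → Q J) (fun _ => hbot) ?_ J
  intro J J' t hlt hmJ htJ htJ' hsup ih hJJ₀
  exact hstep t hJJ₀ hlt hmJ htJ htJ' hsup (ih (hlt.le.trans hJJ₀))

/-- **Descent along principal small rungs** (the downward reading): if `Q J₀` and every rung transfers `Q` from `J` to `J'`
(for `J ≤ J₀`), then `Q ⊥` — `A/J₀` is joined to `A` by finitely many principal small extensions.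
[cite: StacksProject, Tag 06GE (Lemma 90.3.3 and proof)] -/
theorem descent_on_principalSmall (J₀ : Ideal A) {Q : Ideal A → Prop} (htop : Q J₀)
    (hstep : ∀ ⦃J J' : Ideal A⦄ (t : A), J ≤ J₀ → J' < J → maximalIdeal A * J ≤ J' → t ∈ J → t ∉ J' →
      J' ⊔ Ideal.span {t} = J → Q J → Q J') :
    Q ⊥ := by
  -- motive: `Q J → Q ⊥`, climbed upward to `J₀`
  have key : ∀ {J : Ideal A}, J ≤ J₀ → Q J → Q ⊥ := fun {J} hJ =>
    induction_on_principalSmall_le J₀ (Q := fun J => Q J → Q ⊥) (fun h => h)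
      (fun J J' t hJJ₀ hlt hmJ htJ htJ' hsup ih hQJ => ih (hstep t hJJ₀ hlt hmJ htJ htJ' hsup hQJ)) hJ
  exact key le_rfl htop

end Induction

end Literature.RingTheory.Artinian

end
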